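import Literature.MathematicalPhysics.QuantumManyBody.PeriodicBoseGas
import Literature.MathematicalPhysics.QuantumManyBody.GroundState
import Literature.MathematicalPhysics.QuantumManyBody.SwapPurity
import Summits.AtomisticToContinuum.BoseEinsteinCondensation.Theorems.BECInsertionVarianceGroundStateAccessibleExistence
import Summits.AtomisticToContinuum.BoseEinsteinCondensation.Theorems.BECThomsonPrinciplePeriodicToDirichletInnerFlatToBEC
import Summits.AtomisticToContinuum.BoseEinsteinCondensation.Theorems.BECInsertionCorrectorBoundaryTransferWeakMultiplicativeTransfer
import Mathlib.MeasureTheory.Measure.WithDensity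
import Mathlib.Analysis.SpecialFunctions.Exp
import Mathlib.Analysis.SpecialFunctions.Pow.Real
import Summits.AtomisticToContinuum.BoseEinsteinCondensation.Theses.BECInsertionCorrector
import Summits.AtomisticToContinuum.BoseEinsteinCondensation.Theses.BECPeriodicReduction
import Summits.AtomisticToContinuum.BoseEinsteinCondensation.Theorems.BECInsertionCorrectorBoundaryTransferWeakClosing
import Summits.AtomisticToContinuum.BoseEinsteinCondensation.Theorems.BECInsertionCorrectorBoundaryTransferWeakTorusTypicalityBath

/-!
# Crux `BoundaryTransferWeak` (stmt-AtomisticToContinuum-0827, routes `BECInsertionCorrector` /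
# `BECPeriodicReduction` / `BECProbeMassFlow`), line `Sketch` (coupled-bath-relocation), skeleton v3:
# stub `stub_boxTransferL1`

**Box transfer, bath level, with the L¹ exceptional-set clause (the coupling arithmetic, v3).**
This is the v3 form of the landed `stub_boxTransferBath` (v2, `…BoxTransferBath.lean`): the clause
`|S| ≤ ε|C|` (relative VOLUME of the exceptional set) of the good event is replaced by
`∫_S φ ≤ ε ∫_C φ` (relative in-cube L¹ mass of the torus slice), and the tolerance hypotheses
`ε ≤ √c/8`, `ε ≤ 1/2` by the single `ε < 1`.  Point of the change (lead c1): in v2 the exceptional-set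
tolerance had to be small against the UNQUANTIFIED constant `c` of the torus-BEC instance, which forced
the line's research stub to be stated for every `ε > 0` and, for hard cores below the core scale, to
match bulk cores near-exactly under the coupling; with the L¹ clause every loss is a power of `(1-ε)`,
the flatness constant is `κ₀ = e^{-2M}(1-ε)³ c/16`, and the box constant is positive for every `ε < 1`,
so the research stub may take `ε` existential and put all cores into the exceptional sets.

Setting: `Ψ_D = groundState v (n+1) L` (law `Q = Ψ_D² dZ`, mass one when `E₀ < ⊤`), `Φ` a periodic
trial state (law `P = |Φ|² 1_{cellⁿ⁺¹} dW`), `C = (L/4, 3L/4)³` the inner cube, `u = |C|^{-1/2} 1_C`.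
A coupling `π` of `Q, P` whose good event `G` of mass `≥ 1 - η` controls, for the slices
`ψ = Ψ_D(·, tail Z) ≥ 0`, `φ = |Φ(·, tail W)|`, the relative relocation cost on `C` off an
exceptional `S ⊆ C` (`ψ(x)φ(y) ≤ e^M ψ(y)φ(x)`; `S` carries `≤ ε` of `∫_C φ`, of `∫_C ψ²` and of
`∫_C φ²`) and, one-directionally, from `C` to the rest of the cell off a `ψ`-small `T`
(`ψ(y)φ(x) ≤ e^M ψ(x)φ(y)`), and a `P`-event `E` of mass `≥ c/16` of BATHS on which `φ` has in-cube
cell-mass fraction `≥ c/16` and Bhattacharyya flatness `(∫_C φ)² ≥ (c/16)|C| ∫_C φ²`, give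
`n_u(Ψ_D) ≥ κ (n+1)`, `κ = (c/16 - η) κ₀ κ₁ / 2`, `κ₁ = (1-ε)/(1 + 16e^{2M}/(c(1-ε)))`:
(1) `n_u/(n+1) ≥ E_Q[f]`, `f(Z) = (∫_C ψ)²/(|C| ∫ ψ²)` (Tonelli; `slice_bound`);
(2) `E_Q[f] ≥ κ₀κ₁ π(G ∩ snd⁻¹E) ≥ κ₀κ₁(c/16 - η)`; (3) on `G ∩ snd⁻¹E`,
`(∫_C ψ)² ≥ κ₀ |C| ∫_C ψ²` (`flatness_coreL1`: the multiplicative transfer on `C ∖ S`,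
`∫_{C∖S} φ ≥ (1-ε) ∫_C φ`, `∫_{C∖S} ψ² ≥ (1-ε) ∫_C ψ²`, `(∫_C φ)² ≥ (c/16)|C|∫_C φ²`) and
`∫_C ψ² ≥ κ₁ ∫ ψ²` (`massFraction_core`, landed, unchanged). [folklore]
-/

noncomputable section

namespace Summit.AtomisticToContinuum.BoseEinsteinCondensation.CoupledBaths

open Literature.MathematicalPhysics.QuantumManyBody.BoseGas MeasureTheory Filter
open scoped ENNReal NNReal ComplexConjugate
open BoxTransferBath
open ENNReal (ofReal)
open Matrix (vecCons vecTail)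

/-- `Y ↦ ∫_Q G(x :: Y) dx` is measurable (Tonelli). [folklore] -/
private theorem measurable_setLIntegral_vecCons {n : ℕ} {G : Config (n + 1) → ℝ≥0∞}
    (hG : Measurable G) (Q : Set Space) :
    Measurable fun Y : Config n => ∫⁻ x in Q, G (Matrix.vecCons x Y) :=
  -- adapted from …Theorems/BECInsertionCorrectorBoundaryTransferWeakBoxTransfer.lean
  (hG.comp (measurable_vecCons.comp measurable_swap)).lintegral_prod_right'

/-- `Y ↦ ∫ G(x :: Y) dx` is measurable (Tonelli). [folklore] -/
private theorem measurable_lintegral_vecCons {n : ℕ} {G : Config (n + 1) → ℝ≥0∞}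
    (hG : Measurable G) : Measurable fun Y : Config n => ∫⁻ x, G (Matrix.vecCons x Y) :=
  (hG.comp (measurable_vecCons.comp measurable_swap)).lintegral_prod_right'

/-- Mass-one coupling: `π G ≥ 1 - η` and `π T ≥ c'` give `π (G ∩ T) ≥ c' - η`. [folklore] -/
private theorem le_measure_inter_of_compl {Ω : Type*} [MeasurableSpace Ω] {π : Measure Ω}
    (hπ : π Set.univ = 1) {G T : Set Ω} (hG : MeasurableSet G) {η c' : ℝ} (hη : 0 ≤ η)
    (hGπ : ENNReal.ofReal (1 - η) ≤ π G) (hT : ENNReal.ofReal c' ≤ π T) :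
    ENNReal.ofReal (c' - η) ≤ π (G ∩ T) := by
  -- adapted from …Theorems/BECInsertionCorrectorBoundaryTransferWeakBoxTransfer.lean
  have hcompl : π Gᶜ ≤ ENNReal.ofReal η := by
    refine (ENNReal.add_le_add_iff_right (a := ENNReal.ofReal (1 - η)) ENNReal.ofReal_ne_top).mp ?_
    calc π Gᶜ + ENNReal.ofReal (1 - η) ≤ π Gᶜ + π G := add_le_add le_rfl hGπ
      _ = 1 := by rw [add_comm, measure_add_measure_compl hG, hπ]
      _ = ENNReal.ofReal (η + (1 - η)) := by rw [add_sub_cancel, ENNReal.ofReal_one]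
      _ ≤ ENNReal.ofReal η + ENNReal.ofReal (1 - η) := ENNReal.ofReal_add_le
  have hsplit : π T ≤ π (G ∩ T) + π Gᶜ :=
    calc π T = π (T ∩ G) + π (T \ G) := (measure_inter_add_sdiff _ hG).symm
      _ ≤ π (G ∩ T) + π Gᶜ :=
          add_le_add (by rw [Set.inter_comm]) (measure_mono fun x hx => hx.2)
  rw [ENNReal.ofReal_sub _ hη]
  exact (tsub_le_tsub hT hcompl).trans (tsub_le_iff_right.mpr hsplit)

/-- **`E_Q` of a bath functional** (Tonelli in `Z = x :: Y`):
`∫ B(tail Z) g(Z)² dZ = ∫ (∫ g(x :: Y)² dx) B(Y) dY`. [folklore] -/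
private theorem lintegral_tail_withDensity {n : ℕ} {g : Config (n + 1) → ℝ} (hg : Measurable g)
    {B : Config n → ℝ≥0∞} (hB : Measurable B) :
    ∫⁻ Z, B (Matrix.vecTail Z) ∂(volume.withDensity fun Z => ENNReal.ofReal (g Z) ^ 2) =
      ∫⁻ Y, (∫⁻ x, ENNReal.ofReal (g (Matrix.vecCons x Y)) ^ 2) * B Y := by
  have hρ : Measurable fun Z => ENNReal.ofReal (g Z) ^ 2 := hg.ennreal_ofReal.pow_const 2
  have hF : Measurable fun Z : Config (n + 1) => B (Matrix.vecTail Z) :=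
    hB.comp measurable_vecTail
  rw [lintegral_withDensity_eq_lintegral_mul _ hρ hF, lintegral_config_succ (hρ.mul hF)]
  refine lintegral_congr fun Y => ?_
  simp only [Pi.mul_apply, Matrix.tail_cons]
  exact lintegral_mul_const _
    (hρ.comp (continuous_id.matrixVecCons continuous_const).measurable)

/-- **Flatness transfer, L¹ form** (the pointwise `BC_C` core of the v3 box transfer): under the
multiplicative transfer `MFT` on `C ∖ S`, the two-sided relocation bound, the L¹ clause
`∫_S φ ≤ ε ∫_C φ`, the L² clause `∫_S ψ² ≤ ε ∫_C ψ²` and the torus flatness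
`(c/16)|C| ∫_C φ² ≤ (∫_C φ)²` give `(∫_C ψ)² ≥ e^{-2M}(1-ε)³(c/16) |C| ∫_C ψ²` — for EVERY `ε < 1`.
[folklore] -/
private theorem flatness_coreL1
    (MFT : ∀ (C : Set Space) (f g : Space → ℝ) (M : ℝ), MeasurableSet C → Measurable f →
      Measurable g → (∀ x ∈ C, 0 ≤ f x) → (∀ x ∈ C, 0 ≤ g x) →
      (∀ x ∈ C, ∀ y ∈ C, f x * g y ≤ Real.exp M * (f y * g x)) →
        (∫⁻ x in C, ENNReal.ofReal (g x)) ^ 2 * ∫⁻ x in C, ENNReal.ofReal (f x) ^ 2 ≤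
          ENNReal.ofReal (Real.exp (2 * M)) *
            ((∫⁻ x in C, ENNReal.ofReal (f x)) ^ 2 * ∫⁻ x in C, ENNReal.ofReal (g x) ^ 2))
    {C S : Set Space} {ψ φ : Space → ℝ} {c ε M : ℝ} (hC : MeasurableSet C) (hVt : volume C ≠ ⊤)
    (hψm : Measurable ψ) (hφm : Measurable φ) (hψ0 : ∀ x, 0 ≤ ψ x) (hφ0 : ∀ x, 0 ≤ φ x)
    (hc : 0 < c) (hε : 0 < ε) (hε1 : ε < 1)
    (hmt : ∫⁻ x in C, ENNReal.ofReal (ψ x) ^ 2 < ⊤) (hmφ0 : 0 < ∫⁻ y in C, ENNReal.ofReal (φ y) ^ 2)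
    (hmφt : ∫⁻ y in C, ENNReal.ofReal (φ y) ^ 2 < ⊤)
    (hflat : ENNReal.ofReal (c / 16) * (volume C * ∫⁻ y in C, ENNReal.ofReal (φ y) ^ 2) ≤
      (∫⁻ y in C, ENNReal.ofReal (φ y)) ^ 2)
    (hSC : S ⊆ C) (hS : MeasurableSet S)
    (hSφ1 : ∫⁻ y in S, ENNReal.ofReal (φ y) ≤ ENNReal.ofReal ε * ∫⁻ y in C, ENNReal.ofReal (φ y))
    (hSψ : ∫⁻ x in S, ENNReal.ofReal (ψ x) ^ 2 ≤
      ENNReal.ofReal ε * ∫⁻ x in C, ENNReal.ofReal (ψ x) ^ 2)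
    (hpair : ∀ x ∈ C \ S, ∀ y ∈ C \ S, ψ x * φ y ≤ Real.exp M * (ψ y * φ x)) :
    ENNReal.ofReal (Real.exp (-2 * M) * ((1 - ε) ^ 3 * (c / 16))) *
        (volume C * ∫⁻ x in C, ENNReal.ofReal (ψ x) ^ 2) ≤
      (∫⁻ x in C, ENNReal.ofReal (ψ x)) ^ 2 := by
  -- adapted from …Theorems/BECInsertionCorrectorBoundaryTransferWeakBoxTransferBath.lean (v2 core)
  set V : ℝ≥0∞ := volume C with hVdef
  set J : ℝ≥0∞ := ∫⁻ x in C, ENNReal.ofReal (ψ x) with hJdef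
  set m : ℝ≥0∞ := ∫⁻ x in C, ENNReal.ofReal (ψ x) ^ 2 with hmdef
  set Jφ : ℝ≥0∞ := ∫⁻ y in C, ENNReal.ofReal (φ y) with hJφdef
  set mφ : ℝ≥0∞ := ∫⁻ y in C, ENNReal.ofReal (φ y) ^ 2 with hmφdef
  have h1ε : 0 < 1 - ε := by linarith
  have hsplit (f : Space → ℝ≥0∞) : (∫⁻ x in S, f x) + ∫⁻ x in C \ S, f x = ∫⁻ x in C, f x := by
    simpa only [Set.inter_eq_self_of_subset_right hSC] using
      lintegral_inter_add_sdiff (μ := volume) f C hS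
  -- the multiplicative transfer on `C ∖ S`
  have hMFT := MFT (C \ S) ψ φ M (hC.diff hS) hψm hφm (fun x _ => hψ0 x) (fun x _ => hφ0 x) hpair
  have h1 : (∫⁻ x in C \ S, ENNReal.ofReal (ψ x)) ≤ J := lintegral_mono_set Set.sdiff_subset
  have h2 : (∫⁻ x in C \ S, ENNReal.ofReal (φ x) ^ 2) ≤ mφ := lintegral_mono_set Set.sdiff_subset
  -- `∫_{C∖S} ψ² ≥ (1 - ε) ∫_C ψ²` (L² clause for `ψ`)
  have hmA : ENNReal.ofReal (1 - ε) * m ≤ ∫⁻ x in C \ S, ENNReal.ofReal (ψ x) ^ 2 := by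
    refine (ENNReal.add_le_add_iff_right (a := ENNReal.ofReal ε * m)
      (ENNReal.mul_ne_top ENNReal.ofReal_ne_top hmt.ne)).mp ?_
    calc ENNReal.ofReal (1 - ε) * m + ENNReal.ofReal ε * m = m := by
          rw [← add_mul, ← ENNReal.ofReal_add h1ε.le hε.le, sub_add_cancel,
            ENNReal.ofReal_one, one_mul]
      _ = (∫⁻ x in S, ENNReal.ofReal (ψ x) ^ 2) + ∫⁻ x in C \ S, ENNReal.ofReal (ψ x) ^ 2 :=
          (hsplit fun x => ENNReal.ofReal (ψ x) ^ 2).symm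
      _ ≤ (∫⁻ x in C \ S, ENNReal.ofReal (ψ x) ^ 2) + ENNReal.ofReal ε * m := by
          rw [add_comm]; exact add_le_add le_rfl hSψ
  -- `Jφ < ⊤` (Cauchy–Schwarz against `1` on `C`)
  have hVmφ : V * mφ ≠ ⊤ := ENNReal.mul_ne_top hVt hmφt.ne
  have hJφt : Jφ ≠ ⊤ := fun h => by
    have h' := sq_setLIntegral_le hφm.ennreal_ofReal C
    rw [← hJφdef, h, ENNReal.top_pow two_ne_zero, top_le_iff] at h'
    exact hVmφ h'
  -- `∫_{C∖S} φ ≥ (1 - ε) ∫_C φ` (L¹ clause for `φ`)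
  have hJφA : ENNReal.ofReal (1 - ε) * Jφ ≤ ∫⁻ y in C \ S, ENNReal.ofReal (φ y) := by
    refine (ENNReal.add_le_add_iff_right (a := ENNReal.ofReal ε * Jφ)
      (ENNReal.mul_ne_top ENNReal.ofReal_ne_top hJφt)).mp ?_
    calc ENNReal.ofReal (1 - ε) * Jφ + ENNReal.ofReal ε * Jφ = Jφ := by
          rw [← add_mul, ← ENNReal.ofReal_add h1ε.le hε.le, sub_add_cancel,
            ENNReal.ofReal_one, one_mul]
      _ = (∫⁻ y in S, ENNReal.ofReal (φ y)) + ∫⁻ y in C \ S, ENNReal.ofReal (φ y) :=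
          (hsplit fun y => ENNReal.ofReal (φ y)).symm
      _ ≤ (∫⁻ y in C \ S, ENNReal.ofReal (φ y)) + ENNReal.ofReal ε * Jφ := by
          rw [add_comm]; exact add_le_add le_rfl hSφ1
  -- square it and combine with the torus flatness: `(1-ε)² (c/16) V mφ ≤ (∫_{C∖S} φ)²`
  have hkey : ENNReal.ofReal ((1 - ε) ^ 2 * (c / 16)) * (V * mφ) ≤
      (∫⁻ y in C \ S, ENNReal.ofReal (φ y)) ^ 2 :=
    calc ENNReal.ofReal ((1 - ε) ^ 2 * (c / 16)) * (V * mφ)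
        = ENNReal.ofReal (1 - ε) ^ 2 * (ENNReal.ofReal (c / 16) * (V * mφ)) := by
          rw [ENNReal.ofReal_mul (sq_nonneg _), ENNReal.ofReal_pow h1ε.le]; ring
      _ ≤ ENNReal.ofReal (1 - ε) ^ 2 * Jφ ^ 2 := mul_le_mul' le_rfl hflat
      _ = (ENNReal.ofReal (1 - ε) * Jφ) ^ 2 := by rw [mul_pow]
      _ ≤ (∫⁻ y in C \ S, ENNReal.ofReal (φ y)) ^ 2 := pow_le_pow_left' hJφA 2
  -- combine with the transfer and cancel `mφ ∈ (0, ⊤)`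
  have hcomb : ENNReal.ofReal ((1 - ε) ^ 3 * (c / 16)) * (V * m) * mφ ≤
      ENNReal.ofReal (Real.exp (2 * M)) * J ^ 2 * mφ :=
    calc ENNReal.ofReal ((1 - ε) ^ 3 * (c / 16)) * (V * m) * mφ
        = ENNReal.ofReal ((1 - ε) ^ 2 * (c / 16)) * (V * mφ) *
            (ENNReal.ofReal (1 - ε) * m) := by
          rw [show (1 - ε) ^ 3 * (c / 16) = (1 - ε) ^ 2 * (c / 16) * (1 - ε) by ring,
            ENNReal.ofReal_mul (by positivity)]
          ring
      _ ≤ (∫⁻ y in C \ S, ENNReal.ofReal (φ y)) ^ 2 * ∫⁻ x in C \ S, ENNReal.ofReal (ψ x) ^ 2 :=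
          mul_le_mul' hkey hmA
      _ ≤ ENNReal.ofReal (Real.exp (2 * M)) * ((∫⁻ x in C \ S, ENNReal.ofReal (ψ x)) ^ 2 *
            ∫⁻ x in C \ S, ENNReal.ofReal (φ x) ^ 2) := hMFT
      _ ≤ ENNReal.ofReal (Real.exp (2 * M)) * (J ^ 2 * mφ) := by gcongr
      _ = ENNReal.ofReal (Real.exp (2 * M)) * J ^ 2 * mφ := by ring
  have hcancel : ENNReal.ofReal ((1 - ε) ^ 3 * (c / 16)) * (V * m) ≤
      ENNReal.ofReal (Real.exp (2 * M)) * J ^ 2 :=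
    (ENNReal.mul_le_mul_iff_left hmφ0.ne' hmφt.ne).mp hcomb
  calc ENNReal.ofReal (Real.exp (-2 * M) * ((1 - ε) ^ 3 * (c / 16))) * (V * m)
      = ENNReal.ofReal (Real.exp (-2 * M)) *
          (ENNReal.ofReal ((1 - ε) ^ 3 * (c / 16)) * (V * m)) := by
        rw [ENNReal.ofReal_mul (Real.exp_pos _).le, mul_assoc]
    _ ≤ ENNReal.ofReal (Real.exp (-2 * M)) * (ENNReal.ofReal (Real.exp (2 * M)) * J ^ 2) :=
        mul_le_mul' le_rfl hcancel
    _ = J ^ 2 := by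
        rw [← mul_assoc, ← ENNReal.ofReal_mul (Real.exp_pos _).le, ← Real.exp_add,
          show -2 * M + 2 * M = 0 by ring, Real.exp_zero, ENNReal.ofReal_one, one_mul]

/-- **Registered stub `stub_boxTransferL1`** (B‴ of line `Sketch`, skeleton v3, crux
stmt-AtomisticToContinuum-0827; the skeleton's bath-level `BoxTransfer` v3, unfolded): the
multiplicative flatness transfer, a coupling with a v3 good event of mass `≥ 1 - η` (two-sided
relocation bound on the inner cube off an exceptional set that is L¹-small for the torus slice and
L²-small for both slices; one-directional bound towards the rest of the cell) and a torus-typical bath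
event of mass `≥ c/16` give inner flat-mode occupation `≥ κ(c,ε,η,M)·(n+1)` of the Dirichlet ground
state, for every tolerance `ε < 1`. [folklore] -/
theorem stub_boxTransferL1 :
    (∀ (C : Set Space) (f g : Space → ℝ) (M : ℝ), MeasurableSet C → Measurable f → Measurable g →
      (∀ x ∈ C, 0 ≤ f x) → (∀ x ∈ C, 0 ≤ g x) →
      (∀ x ∈ C, ∀ y ∈ C, f x * g y ≤ Real.exp M * (f y * g x)) →
        (∫⁻ x in C, ofReal (g x)) ^ 2 * ∫⁻ x in C, ofReal (f x) ^ 2 ≤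
          ofReal (Real.exp (2 * M)) *
            ((∫⁻ x in C, ofReal (f x)) ^ 2 * ∫⁻ x in C, ofReal (g x) ^ 2)) →
    ∀ (v : ℝ → ℝ≥0∞) (n : ℕ) (L : ℝ), 0 < L → groundStateEnergy v (n + 1) L ≠ ⊤ →
    ∀ (c ε η M : ℝ), 0 < c → 0 < ε → ε < 1 → 0 < η → η < c / 16 →
    ∀ Φ : PeriodicTrialState (n + 1) L,
      (∃ π : Measure (Config (n + 1) × Config (n + 1)),
        π.map Prod.fst = volume.withDensity (fun Z => ofReal (groundState v (n + 1) L Z) ^ 2) ∧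
        π.map Prod.snd = ((volume.restrict (cellN (n + 1) L)).withDensity fun W => (‖Φ.ψ W‖₊ : ℝ≥0∞) ^ 2) ∧
        ∃ G : Set (Config (n + 1) × Config (n + 1)), MeasurableSet G ∧
          ofReal (1 - η) ≤ π G ∧
          ∀ p ∈ G,
              0 < ∫⁻ x in {x : Space | ∀ t, x t ∈ Set.Ioo (1 / 4 * L) (L - 1 / 4 * L)},
                  ofReal (groundState v (n + 1) L (vecCons x (vecTail p.1))) ^ 2 ∧
              ∫⁻ x in {x : Space | ∀ t, x t ∈ Set.Ioo (1 / 4 * L) (L - 1 / 4 * L)},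
                  ofReal (groundState v (n + 1) L (vecCons x (vecTail p.1))) ^ 2 < ⊤ ∧
              ∫⁻ x, ofReal (groundState v (n + 1) L (vecCons x (vecTail p.1))) ^ 2 < ⊤ ∧
              ∃ S ⊆ {x : Space | ∀ t, x t ∈ Set.Ioo (1 / 4 * L) (L - 1 / 4 * L)},
                MeasurableSet S ∧
                ∫⁻ y in S, ofReal ‖Φ.ψ (vecCons y (vecTail p.2))‖ ≤
                  ofReal ε * ∫⁻ y in {x : Space | ∀ t, x t ∈ Set.Ioo (1 / 4 * L) (L - 1 / 4 * L)},
                    ofReal ‖Φ.ψ (vecCons y (vecTail p.2))‖ ∧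
                ∫⁻ x in S, ofReal (groundState v (n + 1) L (vecCons x (vecTail p.1))) ^ 2 ≤
                  ofReal ε * ∫⁻ x in {x : Space | ∀ t, x t ∈ Set.Ioo (1 / 4 * L) (L - 1 / 4 * L)},
                    ofReal (groundState v (n + 1) L (vecCons x (vecTail p.1))) ^ 2 ∧
                ∫⁻ y in S, ofReal ‖Φ.ψ (vecCons y (vecTail p.2))‖ ^ 2 ≤
                  ofReal ε * ∫⁻ y in {x : Space | ∀ t, x t ∈ Set.Ioo (1 / 4 * L) (L - 1 / 4 * L)},
                    ofReal ‖Φ.ψ (vecCons y (vecTail p.2))‖ ^ 2 ∧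
                (∀ x ∈ {x : Space | ∀ t, x t ∈ Set.Ioo (1 / 4 * L) (L - 1 / 4 * L)} \ S,
                  ∀ y ∈ {x : Space | ∀ t, x t ∈ Set.Ioo (1 / 4 * L) (L - 1 / 4 * L)} \ S,
                    groundState v (n + 1) L (vecCons x (vecTail p.1)) * ‖Φ.ψ (vecCons y (vecTail p.2))‖ ≤
                      Real.exp M * (groundState v (n + 1) L (vecCons y (vecTail p.1)) * ‖Φ.ψ (vecCons x (vecTail p.2))‖)) ∧
                ∃ T : Set Space, MeasurableSet T ∧
                  ∫⁻ y in T, ofReal (groundState v (n + 1) L (vecCons y (vecTail p.1))) ^ 2 ≤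
                    ofReal ε * ∫⁻ x, ofReal (groundState v (n + 1) L (vecCons x (vecTail p.1))) ^ 2 ∧
                  ∀ x ∈ {x : Space | ∀ t, x t ∈ Set.Ioo (1 / 4 * L) (L - 1 / 4 * L)} \ S,
                    ∀ y ∈ (cell L \ {x : Space | ∀ t, x t ∈ Set.Ioo (1 / 4 * L) (L - 1 / 4 * L)}) \ T,
                      groundState v (n + 1) L (vecCons y (vecTail p.1)) * ‖Φ.ψ (vecCons x (vecTail p.2))‖ ≤
                        Real.exp M * (groundState v (n + 1) L (vecCons x (vecTail p.1)) * ‖Φ.ψ (vecCons y (vecTail p.2))‖)) →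
      (∃ E : Set (Config (n + 1)), MeasurableSet E ∧
        ofReal (c / 16) ≤ ((volume.restrict (cellN (n + 1) L)).withDensity fun W => (‖Φ.ψ W‖₊ : ℝ≥0∞) ^ 2) E ∧
        ∀ W ∈ E,
            0 < ∫⁻ y in {x : Space | ∀ t, x t ∈ Set.Ioo (1 / 4 * L) (L - 1 / 4 * L)},
                ofReal ‖Φ.ψ (vecCons y (vecTail W))‖ ^ 2 ∧
            ∫⁻ y in cell L, ofReal ‖Φ.ψ (vecCons y (vecTail W))‖ ^ 2 < ⊤ ∧
            ofReal (c / 16) * ∫⁻ y in cell L, ofReal ‖Φ.ψ (vecCons y (vecTail W))‖ ^ 2 ≤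
              ∫⁻ y in {x : Space | ∀ t, x t ∈ Set.Ioo (1 / 4 * L) (L - 1 / 4 * L)},
                ofReal ‖Φ.ψ (vecCons y (vecTail W))‖ ^ 2 ∧
            ofReal (c / 16) *
                (volume {x : Space | ∀ t, x t ∈ Set.Ioo (1 / 4 * L) (L - 1 / 4 * L)} *
                  ∫⁻ y in {x : Space | ∀ t, x t ∈ Set.Ioo (1 / 4 * L) (L - 1 / 4 * L)},
                    ofReal ‖Φ.ψ (vecCons y (vecTail W))‖ ^ 2) ≤
              (∫⁻ y in {x : Space | ∀ t, x t ∈ Set.Ioo (1 / 4 * L) (L - 1 / 4 * L)},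
                  ofReal ‖Φ.ψ (vecCons y (vecTail W))‖) ^ 2) →
      ofReal ((c / 16 - η) * ((Real.exp (-2 * M) * ((1 - ε) ^ 3 * (c / 16))) *
          ((1 - ε) / (1 + 16 * Real.exp (2 * M) / (c * (1 - ε))))) / 2 *
          (n + 1 : ℕ)) ≤
        occupation (n + 1)
          (Set.indicator {x : Space | ∀ t, x t ∈ Set.Ioo (1 / 4 * L) (L - 1 / 4 * L)}
            (fun _ => ((Real.sqrt (((1 - 2 * (1 / 4)) * L) ^ 3))⁻¹ : ℂ)))
          fun Z => (groundState v (n + 1) L Z : ℂ) := by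
  intro MFT v n L hL hE c ε η M hc hε hε1 hη hηc Φ hπ hEev
  obtain ⟨π, hπ1, hπ2, G, hG, hGπ, hgood⟩ := hπ
  obtain ⟨E, hEm, hEP, hEgood⟩ := hEev
  -- the inner cube, its volume `a²`, the ground state
  set C : Set Space := {x : Space | ∀ t, x t ∈ Set.Ioo (1 / 4 * L) (L - 1 / 4 * L)} with hCdef
  set a : ℝ := Real.sqrt (((1 - 2 * (1 / 4)) * L) ^ 3) with hadef
  set gs : Config (n + 1) → ℝ := groundState v (n + 1) L with hgsdef
  have hCmeas : MeasurableSet C := TorusInTheBox.measurableSet_innerCube (1 / 4) L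
  have hCcell : C ⊆ cell L := fun x hx k =>
    ⟨by linarith [(hx k).1, (hx k).2], by linarith [(hx k).1, (hx k).2]⟩
  have ha0 : 0 < a := Real.sqrt_pos.mpr (by positivity)
  have hV : volume C = ENNReal.ofReal (a ^ 2) := by
    rw [hCdef, TorusInTheBox.volume_innerCube (1 / 4) L, hadef, Real.sq_sqrt (by positivity),
      ENNReal.ofReal_pow (by linarith)]
  have hV0 : volume C ≠ 0 := by rw [hV]; exact (ENNReal.ofReal_pos.mpr (by positivity)).ne'
  have hVt : volume C ≠ ⊤ := by rw [hV]; exact ENNReal.ofReal_ne_top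
  have hgm : Measurable gs := measurable_groundState v (n + 1) L
  have hg0 : ∀ Z, 0 ≤ gs Z := groundState_nonneg v (n + 1) L
  have hslm : ∀ Y : Config n, Measurable fun x : Space => gs (Matrix.vecCons x Y) := fun Y =>
    hgm.comp (continuous_id.matrixVecCons continuous_const).measurable
  -- the bath functional `f(Z) = B(tail Z)`, `B(Y) = (∫_C ψ_Y)² / (|C| ∫ ψ_Y²)`
  set B : Config n → ℝ≥0∞ := fun Y => (∫⁻ x in C, ENNReal.ofReal (gs (Matrix.vecCons x Y))) ^ 2 /
    (volume C * ∫⁻ x, ENNReal.ofReal (gs (Matrix.vecCons x Y)) ^ 2) with hBdef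
  have hBm : Measurable B :=
    ((measurable_setLIntegral_vecCons hgm.ennreal_ofReal C).pow_const 2).div
      ((measurable_lintegral_vecCons (hgm.ennreal_ofReal.pow_const 2)).const_mul _)
  have hFm : Measurable fun Z : Config (n + 1) => B (Matrix.vecTail Z) :=
    hBm.comp measurable_vecTail
  -- (1) one-bath disintegration: `E_Q[f] ≤ ∫ |⟨u, ψ_Y⟩|² dY`
  have hEQ : ∫⁻ Z, B (Matrix.vecTail Z) ∂(volume.withDensity fun Z => ENNReal.ofReal (gs Z) ^ 2) ≤
      ∫⁻ Y : Config n, (‖∫ x, conj (C.indicator (fun _ => ((a : ℂ))⁻¹) x) *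
        (gs (Matrix.vecCons x Y) : ℂ)‖₊ : ℝ≥0∞) ^ 2 := by
    rw [lintegral_tail_withDensity hgm hBm]
    exact lintegral_mono fun Y => slice_bound hCmeas ha0 hV (hslm Y) (fun x => hg0 _)
      (setLIntegral_le_lintegral _ _)
  -- (2) the coupling: `π` has mass one and `π(G ∩ snd⁻¹ E) ≥ c/16 - η`
  have hπuniv : π Set.univ = 1 := by
    have h : π.map Prod.fst Set.univ = π Set.univ := by
      rw [Measure.map_apply measurable_fst MeasurableSet.univ, Set.preimage_univ]
    rw [← h, hπ1, withDensity_apply _ MeasurableSet.univ, Measure.restrict_univ]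
    exact Theorems.BECInsertionVariance.lintegral_groundState_sq_of_ne_top hE
  have hT : ENNReal.ofReal (c / 16) ≤ π (Prod.snd ⁻¹' E) := by
    rw [← Measure.map_apply measurable_snd hEm, hπ2]; exact hEP
  have hGT : ENNReal.ofReal (c / 16 - η) ≤ π (G ∩ Prod.snd ⁻¹' E) :=
    le_measure_inter_of_compl hπuniv hG hη.le hGπ hT
  -- (3) the pointwise core on `G ∩ snd⁻¹ E`
  have h1ε : 0 < 1 - ε := by linarith
  have hκ₁ : 0 ≤ (1 - ε) / (1 + 16 * Real.exp (2 * M) / (c * (1 - ε))) := by positivity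
  set κ₀ : ℝ := Real.exp (-2 * M) * ((1 - ε) ^ 3 * (c / 16)) with hκ₀def
  set κ₁ : ℝ := (1 - ε) / (1 + 16 * Real.exp (2 * M) / (c * (1 - ε))) with hκ₁def
  have hκ₀ : 0 ≤ κ₀ := by positivity
  have hcore : ∀ p ∈ G ∩ Prod.snd ⁻¹' E, ENNReal.ofReal (κ₀ * κ₁) ≤ B (Matrix.vecTail p.1) := by
    intro p hp
    obtain ⟨hm0, hmt, hmAllt, S, hSC, hS, hSφ1, hSψ, hSφ, hpair, T, hTm, hTψ, hout⟩ :=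
      hgood p hp.1
    obtain ⟨hmφ0, hmφcellt, hfrac, hflat⟩ := hEgood p.2 hp.2
    simp only [hBdef]
    have hφc : Continuous fun y : Space => Φ.ψ (Matrix.vecCons y (Matrix.vecTail p.2)) :=
      Φ.contDiff.continuous.comp (continuous_id.matrixVecCons continuous_const)
    have hmφt :
        ∫⁻ y in C, ENNReal.ofReal ‖Φ.ψ (Matrix.vecCons y (Matrix.vecTail p.2))‖ ^ 2 < ⊤ :=
      lt_of_le_of_lt (lintegral_mono_set hCcell) hmφcellt
    have hψcell : ∀ y, y ∉ cell L → gs (Matrix.vecCons y (Matrix.vecTail p.1)) = 0 := by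
      intro y hy
      refine groundState_eq_zero_of_not_mem v fun hX => hy fun k => ?_
      have hX0 : Matrix.vecCons y (Matrix.vecTail p.1) 0 ∈ box L := hX 0
      rw [Matrix.cons_val_zero] at hX0
      exact Set.Ioo_subset_Ico_self (hX0 k)
    have hmAll0 : ∫⁻ x, ENNReal.ofReal (gs (Matrix.vecCons x (Matrix.vecTail p.1))) ^ 2 ≠ 0 :=
      (hm0.trans_le (setLIntegral_le_lintegral _ _)).ne'
    refine (ENNReal.le_div_iff_mul_le (Or.inl (mul_ne_zero hV0 hmAll0))
      (Or.inl (ENNReal.mul_ne_top hVt hmAllt.ne))).mpr ?_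
    have hflatψ := flatness_coreL1 MFT (ψ := fun x => gs (Matrix.vecCons x (Matrix.vecTail p.1)))
      (φ := fun y => ‖Φ.ψ (Matrix.vecCons y (Matrix.vecTail p.2))‖) hCmeas hVt (hslm _)
      hφc.norm.measurable (fun x => hg0 _) (fun y => norm_nonneg _) hc hε hε1 hmt hmφ0 hmφt
      hflat hSC hS hSφ1 hSψ hpair
    have hmassψ := massFraction_core (ψ := fun x => gs (Matrix.vecCons x (Matrix.vecTail p.1)))
      (φ := fun y => ‖Φ.ψ (Matrix.vecCons y (Matrix.vecTail p.2))‖) (M := M) hCmeas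
      (measurableSet_cell L) hCcell hS hSC hTm (hslm _) hφc.norm.measurable (fun x => hg0 _)
      (fun y => norm_nonneg _) hψcell hc hε hε1 hmAllt hmφ0 hmφcellt hfrac hSφ hTψ hout
    calc ENNReal.ofReal (κ₀ * κ₁) *
          (volume C * ∫⁻ x, ENNReal.ofReal (gs (Matrix.vecCons x (Matrix.vecTail p.1))) ^ 2)
        = ENNReal.ofReal κ₀ * (volume C * (ENNReal.ofReal κ₁ *
            ∫⁻ x, ENNReal.ofReal (gs (Matrix.vecCons x (Matrix.vecTail p.1))) ^ 2)) := by
          rw [ENNReal.ofReal_mul hκ₀]; ring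
      _ ≤ ENNReal.ofReal κ₀ * (volume C *
            ∫⁻ x in C, ENNReal.ofReal (gs (Matrix.vecCons x (Matrix.vecTail p.1))) ^ 2) :=
          mul_le_mul' le_rfl (mul_le_mul' le_rfl hmassψ)
      _ ≤ _ := hflatψ
  -- (4) assemble: `κ₀ κ₁ (c/16 - η) ≤ E_Q[f] ≤ n_u / (n+1)`
  have hmain : ENNReal.ofReal (κ₀ * κ₁) * ENNReal.ofReal (c / 16 - η) ≤
      ∫⁻ Z, B (Matrix.vecTail Z) ∂(volume.withDensity fun Z => ENNReal.ofReal (gs Z) ^ 2) :=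
    calc ENNReal.ofReal (κ₀ * κ₁) * ENNReal.ofReal (c / 16 - η)
        ≤ ENNReal.ofReal (κ₀ * κ₁) * π (G ∩ Prod.snd ⁻¹' E) := mul_le_mul' le_rfl hGT
      _ = ∫⁻ _ in G ∩ Prod.snd ⁻¹' E, ENNReal.ofReal (κ₀ * κ₁) ∂π := (setLIntegral_const _ _).symm
      _ ≤ ∫⁻ p in G ∩ Prod.snd ⁻¹' E, B (Matrix.vecTail p.1) ∂π :=
          setLIntegral_mono (hFm.comp measurable_fst) hcore
      _ ≤ ∫⁻ p, B (Matrix.vecTail p.1) ∂π := setLIntegral_le_lintegral _ _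
      _ = ∫⁻ Z, B (Matrix.vecTail Z) ∂(π.map Prod.fst) := (lintegral_map hFm measurable_fst).symm
      _ = _ := by rw [hπ1]
  have hκ : 0 ≤ κ₀ * κ₁ := mul_nonneg hκ₀ hκ₁
  have hcη : 0 ≤ c / 16 - η := by linarith
  have hfin : (c / 16 - η) * (κ₀ * κ₁) / 2 * ((n + 1 : ℕ) : ℝ) ≤
      κ₀ * κ₁ * (c / 16 - η) * ((n + 1 : ℕ) : ℝ) :=
    mul_le_mul_of_nonneg_right (by nlinarith [mul_nonneg hcη hκ]) (Nat.cast_nonneg _)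
  calc ENNReal.ofReal ((c / 16 - η) * (κ₀ * κ₁) / 2 * ((n + 1 : ℕ) : ℝ))
      ≤ ENNReal.ofReal (κ₀ * κ₁ * (c / 16 - η) * ((n + 1 : ℕ) : ℝ)) := ENNReal.ofReal_le_ofReal hfin
    _ = ENNReal.ofReal (κ₀ * κ₁) * ENNReal.ofReal (c / 16 - η) * ((n + 1 : ℕ) : ℝ≥0∞) := by
        rw [ENNReal.ofReal_mul (mul_nonneg hκ hcη), ENNReal.ofReal_mul hκ, ENNReal.ofReal_natCast]
    _ ≤ _ := mul_le_mul' (hmain.trans hEQ) le_rfl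
    _ = _ := by rw [mul_comm]; push_cast; rfl

end Summit.AtomisticToContinuum.BoseEinsteinCondensation.CoupledBaths

end


/-!
# Crux `BoundaryTransferWeak` (stmt-AtomisticToContinuum-0827), line `Sketch` (idea
# `coupled-bath-relocation`), skeleton v3: the REDUCTION of the crux to the coupled relocation bound
# with the L¹ exceptional-set clause and an existential tolerance

`boundaryTransferWeak_of_coupledRelocationBoundL1 : CoupledRelocationBound‴ → GroundStateRigidity →
BoundaryTransferWeak` — the v3 skeleton (`Cruxes/BoundaryTransferWeak/Lines/Sketch.lean` @ 89bcb545,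
lead c1) with its landed stubs plugged in.  Compared with the v2 reduction
(`…BoundaryTransferWeakReduction.lean`, p144874, lead c0) exactly two things change in the research
hypothesis, both WEAKENINGS in substance:

* the exceptional set `S ⊆ C` of a good pair is no longer asked to have relative VOLUME `≤ ε` but to
  carry `≤ ε` of the torus slice's in-cube L¹ mass, `∫_S φ ≤ ε ∫_C φ` (the volume clause was used only
  to protect the `c`-weak flat overlap of the torus slice, via `(∫_S φ)² ≤ |S| ∫_S φ²`, and that is what
  tied `ε` to the unquantified torus-BEC constant `c` through `ε ≤ √c/8`);
* consequently the tolerance is EXISTENTIAL: `∀ η > 0, ∃ ε ∈ (0,1), ∃ M, …` instead of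
  `∀ ε > 0, ∀ η > 0, ∃ M, …` — the box constant `(c/16-η)·e^{-2M}(1-ε)³(c/16)·κ₁/2` of the v3 box
  transfer (`stub_boxTransferL1`, `…BoxTransferL1.lean`) being positive for every `ε < 1`.

So the line no longer asks, at any density, for the near-exact positional matching of bulk hard cores
that `∀ ε` forced below the core scale (lead c0's analysis in `Lines/Sketch.md`): all cores of both
configurations may be put into `S`/`T`.  What remains is the bounded log-ratio oscillation of the two
slices on the inter-core bulk, in probability under some coupling of the two laws — "weak locality" of
the ground-state conditional amplitude; still without printed source, still the line's one research
stub (`stub_coupledRelocationBoundL1`), written out in full as the first hypothesis below; the second is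
the pooled item `BECWallDressingTransfer.GroundStateRigidity` (stmt-AtomisticToContinuum-9072).

Ingredients (all landed, `--supports stmt-AtomisticToContinuum-0827`): `stub_torusTypicalityBath`
(p141327), `stub_multiplicativeTransfer` (p139456), `stub_boxTransferL1` (v3), `stub_closing` (p140758),
`BECInsertionVariance.eventually_groundStateEnergy_ne_top`.  The assembly is quantifier bookkeeping:
thresholds `min (min ρ_A ρ₁) (min ρ_e ρ₂)`, `η = c/32`, `ε, M` from the hypothesis, the shift
`N = n + 1`, torus slack `min δ_A δ_R`.
-/

noncomputable section

namespace Summit.AtomisticToContinuum.BoseEinsteinCondensation.CoupledBaths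

open Literature.MathematicalPhysics.QuantumManyBody.BoseGas MeasureTheory Filter
open scoped ENNReal NNReal ComplexConjugate
open ENNReal (ofReal)
open Matrix (vecCons vecTail)
open Summit.AtomisticToContinuum.BoseEinsteinCondensation.Theses

/-- The v3 box constant of the line is positive for every `ε < 1`, `η < c/16`. [folklore] -/
private theorem boxConstantL1_pos {c ε η : ℝ} (M : ℝ) (hc : 0 < c) (hε1 : ε < 1)
    (hη : η < c / 16) :
    0 < (c / 16 - η) * ((Real.exp (-2 * M) * ((1 - ε) ^ 3 * (c / 16))) *
          ((1 - ε) / (1 + 16 * Real.exp (2 * M) / (c * (1 - ε))))) / 2 := by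
  have h1 : 0 < c / 16 - η := by linarith
  have h2 : 0 < 1 - ε := by linarith
  positivity

/-- **Reduction of the crux to the coupled relocation bound, v3** (registered as
`boundaryTransferWeak_of_coupledRelocationBoundL1` on stmt-AtomisticToContinuum-0827): the line's
research stub `CoupledRelocationBound` v3 (bath level, L¹ exceptional-set clause, existential tolerance;
first hypothesis, written out) and the pooled `GroundStateRigidity` (stmt-9072) imply the per-potential
boundary-condition transfer `BECPeriodicReduction.BoundaryTransferWeak`.  Proof: the assembly of line
`Sketch` v3 over its landed stubs. [folklore] -/
theorem boundaryTransferWeak_of_coupledRelocationBoundL1 :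
    (∀ v : ℝ → ℝ≥0∞, IsRepulsiveFiniteRange v → ∃ ρ₁ : ℝ, 0 < ρ₁ ∧ ∀ ρ : ℝ, 0 < ρ → ρ < ρ₁ → ∀ η :
      ℝ, 0 < η → ∃ ε M : ℝ, 0 < ε ∧ ε < 1 ∧ ∀ᶠ n : ℕ in atTop, groundStateEnergy v (n + 1)
      (sideLength ρ (n + 1)) ≠ ⊤ → ∃ δ : ℝ≥0∞, 0 < δ ∧ ∀ Φ : PeriodicTrialState (n + 1) (sideLength
      ρ (n + 1)), periodicEnergy v Φ ≤ periodicGroundStateEnergy v (n + 1) (sideLength ρ (n + 1)) +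
      δ → ∃ π : Measure (Config (n + 1) × Config (n + 1)), π.map Prod.fst = volume.withDensity (fun
      Z => ofReal (groundState v (n + 1) (sideLength ρ (n + 1)) Z) ^ 2) ∧ π.map Prod.snd =
      ((volume.restrict (cellN (n + 1) (sideLength ρ (n + 1)))).withDensity fun W => (‖Φ.ψ W‖₊ :
      ℝ≥0∞) ^ 2) ∧ ∃ G : Set (Config (n + 1) × Config (n + 1)), MeasurableSet G ∧ ofReal (1 - η) ≤
      π G ∧ ∀ p ∈ G, 0 < ∫⁻ x in {x : Space | ∀ t, x t ∈ Set.Ioo (1 / 4 * sideLength ρ (n + 1))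
      (sideLength ρ (n + 1) - 1 / 4 * sideLength ρ (n + 1))}, ofReal (groundState v (n + 1)
      (sideLength ρ (n + 1)) (vecCons x (vecTail p.1))) ^ 2 ∧ ∫⁻ x in {x : Space | ∀ t, x t ∈
      Set.Ioo (1 / 4 * sideLength ρ (n + 1)) (sideLength ρ (n + 1) - 1 / 4 * sideLength ρ (n +
      1))}, ofReal (groundState v (n + 1) (sideLength ρ (n + 1)) (vecCons x (vecTail p.1))) ^ 2 < ⊤
      ∧ ∫⁻ x, ofReal (groundState v (n + 1) (sideLength ρ (n + 1)) (vecCons x (vecTail p.1))) ^ 2 <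
      ⊤ ∧ ∃ S ⊆ {x : Space | ∀ t, x t ∈ Set.Ioo (1 / 4 * sideLength ρ (n + 1)) (sideLength ρ (n +
      1) - 1 / 4 * sideLength ρ (n + 1))}, MeasurableSet S ∧ ∫⁻ y in S, ofReal ‖Φ.ψ (vecCons y
      (vecTail p.2))‖ ≤ ofReal ε * ∫⁻ y in {x : Space | ∀ t, x t ∈ Set.Ioo (1 / 4 * sideLength ρ
      (n + 1)) (sideLength ρ (n + 1) - 1 / 4 * sideLength ρ (n + 1))}, ofReal ‖Φ.ψ (vecCons y
      (vecTail p.2))‖ ∧ ∫⁻ x in S, ofReal (groundState v (n + 1) (sideLength ρ (n + 1))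
      (vecCons x (vecTail p.1))) ^ 2 ≤ ofReal ε * ∫⁻ x in {x : Space | ∀ t, x t ∈ Set.Ioo (1 / 4 *
      sideLength ρ (n + 1)) (sideLength ρ (n + 1) - 1 / 4 * sideLength ρ (n + 1))}, ofReal
      (groundState v (n + 1) (sideLength ρ (n + 1)) (vecCons x (vecTail p.1))) ^ 2 ∧ ∫⁻ y in S,
      ofReal ‖Φ.ψ (vecCons y (vecTail p.2))‖ ^ 2 ≤ ofReal ε * ∫⁻ y in {x : Space | ∀ t, x t ∈
      Set.Ioo (1 / 4 * sideLength ρ (n + 1)) (sideLength ρ (n + 1) - 1 / 4 * sideLength ρ (n +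
      1))}, ofReal ‖Φ.ψ (vecCons y (vecTail p.2))‖ ^ 2 ∧ (∀ x ∈ {x : Space | ∀ t, x t ∈ Set.Ioo (1
      / 4 * sideLength ρ (n + 1)) (sideLength ρ (n + 1) - 1 / 4 * sideLength ρ (n + 1))} \ S, ∀ y ∈
      {x : Space | ∀ t, x t ∈ Set.Ioo (1 / 4 * sideLength ρ (n + 1)) (sideLength ρ (n + 1) - 1 / 4
      * sideLength ρ (n + 1))} \ S, groundState v (n + 1) (sideLength ρ (n + 1)) (vecCons x
      (vecTail p.1)) * ‖Φ.ψ (vecCons y (vecTail p.2))‖ ≤ Real.exp M * (groundState v (n + 1)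
      (sideLength ρ (n + 1)) (vecCons y (vecTail p.1)) * ‖Φ.ψ (vecCons x (vecTail p.2))‖)) ∧ ∃ T :
      Set Space, MeasurableSet T ∧ ∫⁻ y in T, ofReal (groundState v (n + 1) (sideLength ρ (n + 1))
      (vecCons y (vecTail p.1))) ^ 2 ≤ ofReal ε * ∫⁻ x, ofReal (groundState v (n + 1) (sideLength ρ
      (n + 1)) (vecCons x (vecTail p.1))) ^ 2 ∧ ∀ x ∈ {x : Space | ∀ t, x t ∈ Set.Ioo (1 / 4 *
      sideLength ρ (n + 1)) (sideLength ρ (n + 1) - 1 / 4 * sideLength ρ (n + 1))} \ S, ∀ y ∈ (cell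
      (sideLength ρ (n + 1)) \ {x : Space | ∀ t, x t ∈ Set.Ioo (1 / 4 * sideLength ρ (n + 1))
      (sideLength ρ (n + 1) - 1 / 4 * sideLength ρ (n + 1))}) \ T, groundState v (n + 1)
      (sideLength ρ (n + 1)) (vecCons y (vecTail p.1)) * ‖Φ.ψ (vecCons x (vecTail p.2))‖ ≤ Real.exp
      M * (groundState v (n + 1) (sideLength ρ (n + 1)) (vecCons x (vecTail p.1)) * ‖Φ.ψ (vecCons y
      (vecTail p.2))‖)) → BECWallDressingTransfer.GroundStateRigidity →
      BECPeriodicReduction.BoundaryTransferWeak := by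
  intro hR hRig v hv hA
  obtain ⟨ρA, hρA, HA⟩ := hA
  obtain ⟨ρ₁, hρ₁, HR⟩ := hR v hv
  obtain ⟨ρe, hρe, HE⟩ :=
    Summit.AtomisticToContinuum.BoseEinsteinCondensation.Theorems.BECInsertionVariance.eventually_groundStateEnergy_ne_top
      hv
  obtain ⟨ρ₂, hρ₂, HC⟩ := stub_closing v hv hRig
  refine ⟨min (min ρA ρ₁) (min ρe ρ₂), lt_min (lt_min hρA hρ₁) (lt_min hρe hρ₂),
    fun ρ hρ hρlt => ?_⟩
  have hρA' : ρ < ρA := hρlt.trans_le ((min_le_left _ _).trans (min_le_left _ _))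
  have hρ₁' : ρ < ρ₁ := hρlt.trans_le ((min_le_left _ _).trans (min_le_right _ _))
  have hρe' : ρ < ρe := hρlt.trans_le ((min_le_right _ _).trans (min_le_left _ _))
  have hρ₂' : ρ < ρ₂ := hρlt.trans_le ((min_le_right _ _).trans (min_le_right _ _))
  obtain ⟨c, hc, hAev⟩ := HA ρ hρ hρA'
  -- the failure tolerance `η`, fixed before `N`; `ε ∈ (0,1)` and `M` come from the hypothesis (v3)
  set η : ℝ := c / 32 with hηdef
  have hη : 0 < η := by positivity
  have hη' : η < c / 16 := by rw [hηdef]; linarith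
  obtain ⟨ε, M, hε, hε1, hRev⟩ := HR ρ hρ hρ₁' η hη
  have hκ := boxConstantL1_pos M hc hε1 hη'
  -- shift `A` and the finiteness of `E₀^D` to `N = n + 1`
  have hAev' := (tendsto_add_atTop_nat 1).eventually hAev
  have hEev' := (tendsto_add_atTop_nat 1).eventually (HE ρ hρ hρe')
  refine HC ρ hρ hρ₂' _ hκ ?_
  filter_upwards [hAev', hEev', hRev] with n hAn hEn hRn
  refine ⟨hEn, ?_⟩
  obtain ⟨δA, hδA, hAΦ⟩ := hAn
  obtain ⟨δR, hδR, hRΦ⟩ := hRn hEn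
  have hL : 0 < sideLength ρ (n + 1) := by
    unfold sideLength
    exact Real.rpow_pos_of_pos (div_pos (Nat.cast_pos.mpr (Nat.succ_pos n)) hρ) _
  -- T′ at slack `min δA δR`: the torus near-minimiser and its typical bath event
  obtain ⟨Φ, hΦE, E, hEm, hPE, hEgood⟩ := stub_torusTypicalityBath v n (sideLength ρ (n + 1)) hL c
    hc (min δA δR) (lt_min hδA hδR)
    fun Φ hΦ => hAΦ Φ (hΦ.trans (add_le_add_right (min_le_left _ _) _))
  -- R′: the coupling with its good event
  obtain ⟨π, hπ1, hπ2, G, hG, hπG, hGood⟩ :=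
    hRΦ Φ (hΦE.trans (add_le_add_right (min_le_right _ _) _))
  -- B′: the inner flat mode of the box is occupied in the Dirichlet ground state
  exact stub_boxTransferL1 stub_multiplicativeTransfer v n (sideLength ρ (n + 1)) hL hEn c ε η M
    hc hε hε1 hη hη' Φ ⟨π, hπ1, hπ2, G, hG, hπG, hGood⟩ ⟨E, hEm, hPE, hEgood⟩

/-- The route copies `BECInsertionCorrector.BoundaryTransferWeak` (lead c0's route) and
`BECPeriodicReduction.BoundaryTransferWeak` (the decl on the item) are the same `Prop` (`rfl`), so the
reduction serves every copy verbatim. [folklore] -/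
example : BECInsertionCorrector.BoundaryTransferWeak = BECPeriodicReduction.BoundaryTransferWeak :=
  rfl

end Summit.AtomisticToContinuum.BoseEinsteinCondensation.CoupledBaths

end
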